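import Literature.Geometry.Kaehler.ComplexTorusAnalyticClasses
import Literature.Geometry.Kaehler.ComplexTorusAnalyticCycleClassFinitePushforward
import HarnessLib

/-!
# Push-forward of analytic classes along a homomorphism with finite kernel: `f_* Aᵖ(X) ⊆ A^{p'}(X')`

Layer `Literature/Geometry/Kaehler`, namespace `Literature.Geometry.Kaehler.ComplexTorus`; lane `lit-hodgefound`
(Track 2 foundations library), Layer A4, skeleton seat `lit-hodgefound-skel-4` (generation 42): fourth RIDER to row
A4-104 (`ComplexTorusAnalyticClasses`), which has `f_* Aᵖ(X) ⊆ Aᵖ(X')` for ISOGENIES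
(`IsIsogeny.coe_gysinMap_mem_analyticClasses`).  Here the same for every homomorphism of complex tori
`f = ρ(A) : X → X'` with FINITE kernel (`dim X ≤ dim X'`; the codimension goes up by `dim X' - dim X`), on the
push-forward of row p07/p08's `ComplexTorusAnalyticCycleClassFinitePushforward` (`f = ι ∘ f̃`: an isogeny onto the
image sub-torus followed by its embedding).

## Sources, verbatim

* W. Fulton, *Intersection Theory* (2nd ed. 1998), §1.4 (pp. 11–12, held p0022–p0023): proper push-forward,
  "`f_*[V] = deg(V/W)[W]`" where `W = f(V)` if `dim W = dim V` and `0` otherwise; §1.7 Example 1.7.4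
  (`f_*[P] = [f(P)]`); §19.1 Lemma 19.1.2 (p. 373): `cl` commutes with push-forward for proper morphisms.
* H. Lange, *Abelian Varieties over the Complex Numbers* (2023), §6.2.1 (p. 300): the cycle class map and
  `f_* : Ch(X) → Ch(Y)` for proper morphisms; §7.3.1 (p. 335) (algebraic classes).
* C. Voisin, *Hodge Theory and Complex Algebraic Geometry I* (2002), §7.3.2 (the Gysin morphism
  `φ_* = PD⁻¹ ∘ ᵗφ^* ∘ PD`; the tree's `gysinMap`, row A1-26).

## Contents (theorems only; no definition, no instance, no named fact — net debt 0)

* **`coe_gysinMap_mem_analyticClasses_of_finite_ker`** — `α ∈ Aᵖ(X) ⟹ f_*α ∈ A^{p'}(X')` (`2p + 2d = rk Λ`,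
  `2p' + 2d = rk Λ'`) for `f` with finite kernel: span induction over the irreducible generators of `Aᵖ(X)`
  (`analyticClasses_eq_span_irreducible`) and `f_*[Z] = deg(Z/f(Z)) · [f(Z)]` (`gysinMap_analyticCycleClass_of_finite_ker`).
* `coe_gysinMap_analyticCycleClass_singleton_mem_analyticClasses` — the point class goes to the point class.

## References

* [Fulton1998] W. Fulton, *Intersection Theory*, 2nd ed., Springer (1998), §1.4, §1.7 Example 1.7.4, §19.1
  Lemma 19.1.2.
* [Lange2023AbelianVarietiesComplex] H. Lange, *Abelian Varieties over the Complex Numbers*, Springer (2023),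
  §6.2.1 (p. 300), §7.3.1 (p. 335).
* [VoisinHodgeI2002] C. Voisin, *Hodge Theory and Complex Algebraic Geometry I*, CUP (2002), §7.3.2.
-/

noncomputable section

open scoped Manifold Matrix
open Set Function Module

namespace Literature.Geometry.Kaehler

namespace ComplexTorus

universe u

/-! ### §0 A span-induction scheme on `Hᵏ(X, ℚ)` -/

section Aux

variable {ι : Type*} {E : Type*} [NormedAddCommGroup E] [NormedSpace ℂ E] (Φ : (ι → ℝ) ≃L[ℝ] E)

/-- Span induction inside `Hᵏ(X, ℚ)`: a `ℚ`-linear map `T` out of `rationalForms Φ k` which sends the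
(rational) members of a set `S` into a subspace `A` sends every element of `span_ℚ S` into `A`.
[cite: Lange2023AbelianVarietiesComplex, §7.3.1 (p. 335)] -/
private theorem map_mem_of_mem_span' {k : ℕ} {N : Type*} [AddCommGroup N] [Module ℚ N]
    (S : Set (E [⋀^Fin k]→L[ℝ] ℂ)) (hS : S ⊆ rationalForms Φ k) (T : rationalForms Φ k →ₗ[ℚ] N)
    (A : Submodule ℚ N) (hgen : ∀ (x : E [⋀^Fin k]→L[ℝ] ℂ) (hx : x ∈ S), T ⟨x, hS hx⟩ ∈ A)
    {x : E [⋀^Fin k]→L[ℝ] ℂ} (hxS : x ∈ Submodule.span ℚ S) (hx : x ∈ rationalForms Φ k) :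
    T ⟨x, hx⟩ ∈ A := by
  have hle : Submodule.span ℚ S ≤ rationalForms Φ k := Submodule.span_le.2 hS
  revert hx
  refine Submodule.span_induction ?_ ?_ ?_ ?_ hxS
  · intro x hx _
    exact hgen x hx
  · intro hx
    have h0 : (⟨0, hx⟩ : rationalForms Φ k) = 0 := rfl
    rw [h0, map_zero]
    exact zero_mem _
  · intro x y hxs hys hPx hPy hxy
    have hxy_eq : (⟨x + y, hxy⟩ : rationalForms Φ k) = ⟨x, hle hxs⟩ + ⟨y, hle hys⟩ := rfl
    rw [hxy_eq, map_add]
    exact add_mem (hPx (hle hxs)) (hPy (hle hys))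
  · intro c x hxs hPx hcx
    have hcx_eq : (⟨c • x, hcx⟩ : rationalForms Φ k) = c • ⟨x, hle hxs⟩ := rfl
    rw [hcx_eq, map_smul]
    exact Submodule.smul_mem _ c (hPx (hle hxs))

end Aux

/-! ### §1 `f_* Aᵖ(X) ⊆ A^{p'}(X')` for a homomorphism with finite kernel -/

section Finite

variable {ι ι' : Type*} [Fintype ι] [Fintype ι'] [DecidableEq ι] [DecidableEq ι'] {E E' : Type u}
  [NormedAddCommGroup E] [InnerProductSpace ℂ E] [FiniteDimensional ℂ E] [MeasurableSpace E] [BorelSpace E]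
  [NormedAddCommGroup E'] [InnerProductSpace ℂ E'] [FiniteDimensional ℂ E'] [MeasurableSpace E']
  [BorelSpace E'] (Φ : (ι → ℝ) ≃L[ℝ] E) (Φ' : (ι' → ℝ) ≃L[ℝ] E') {A : Matrix ι' ι ℤ} {F : E →L[ℂ] E'}
  {n n' : ℕ} (e : Fin n ≃ ι) (e' : Fin n' ≃ ι')

/-- **`f_* Aᵖ(X) ⊆ A^{p'}(X')` for a homomorphism of complex tori `f = ρ(A) : X → X'` with FINITE kernel**
(`ℂ`-linear analytic representation `F`; `p' - p = dim X' - dim X`): the Gysin push-forward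
`f_* = PD⁻¹ ∘ ᵗ(f^*) ∘ PD` (row A1-26) takes analytic classes to analytic classes — on an irreducible `Z ⊆ X` of
codimension `p`, `f_*[Z] = deg(Z/f(Z)) · [f(Z)]` with `f(Z) ⊆ X'` closed analytic of the same DIMENSION (the
tree's `gysinMap_analyticCycleClass_of_finite_ker`: Fulton's `f_*[V] = deg(V/W)[W]`, §1.4, and "`cl` commutes
with push-forward for proper morphisms", Lemma 19.1.2), and `Aᵖ(X)` is spanned by such `[Z]`
(`analyticClasses_eq_span_irreducible`). Covers isogenies and the embeddings of sub-tori.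
[cite: Fulton1998, §1.4 (p. 11–12) and §19.1 Lemma 19.1.2 (p. 373)]
[cite: Lange2023AbelianVarietiesComplex, §6.2.1 (p. 300) and §7.3.1 (p. 335)] -/
theorem coe_gysinMap_mem_analyticClasses_of_finite_ker
    (hF : ∀ x, Φ' ((A.map (Int.cast : ℤ → ℝ)) *ᵥ x) = F (Φ x)) (hfin : Finite (mapMatrixHom Φ Φ' A).ker)
    {p p' d : ℕ} (hX : 2 * p + 2 * d = n) (hX' : 2 * p' + 2 * d = n')
    {α : rationalForms Φ (2 * p)} (hα : (α : E [⋀^Fin (2 * p)]→L[ℝ] ℂ) ∈ analyticClasses Φ e p) :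
    ((gysinMap Φ Φ' e e' hX hX' A α : rationalForms Φ' (2 * p')) : E' [⋀^Fin (2 * p')]→L[ℝ] ℂ) ∈
      analyticClasses Φ' e' p' := by
  have hXs : 2 * d + 2 * p = n := (Nat.add_comm _ _).trans hX
  -- the generating set: classes of the irreducible analytic subsets of dimension `d`
  set S := {γ | ∃ (Z : Set (ComplexTorus Φ)) (_ : IsIrreducibleAnalyticSet 𝓘(ℂ, E) Z)
    (hZ : HasPureDim 𝓘(ℂ, E) Z d), γ = analyticCycleClass Φ e hXs hZ} with hS
  have hSr : S ⊆ rationalForms Φ (2 * p) := by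
    rintro _ ⟨Z, _, hZ, rfl⟩
    exact analyticCycleClass_mem_rationalForms Φ e hXs hZ
  rw [analyticClasses_eq_span_irreducible Φ e hXs] at hα
  refine map_mem_of_mem_span' Φ S hSr
    ((rationalForms Φ' (2 * p')).subtype.comp (gysinMap Φ Φ' e e' hX hX' A)) (analyticClasses Φ' e' p')
    ?_ hα α.2
  rintro _ ⟨Z, hZi, hZ, rfl⟩
  have hg := gysinMap_analyticCycleClass_of_finite_ker Φ Φ' e e' hF hfin hZi hZ hX hX'
  have hx_eq : (⟨analyticCycleClass Φ e hXs hZ, hSr ⟨Z, hZi, hZ, rfl⟩⟩ : rationalForms Φ (2 * p)) =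
      ⟨analyticCycleClass Φ e ((Nat.add_comm (2 * d) (2 * p)).trans hX) hZ,
        analyticCycleClass_mem_rationalForms Φ e _ hZ⟩ := rfl
  rw [LinearMap.comp_apply, hx_eq, hg, Submodule.subtype_apply, Submodule.coe_smul_of_tower]
  exact Submodule.smul_of_tower_mem _ _
    (analyticCycleClass_mem_analyticClasses Φ' e' _ (hasPureDim_image_of_finite_ker Φ Φ' hF hfin hZ))

/-- **`f_*[x] = [f(x)]`: the push-forward of the class of a point is the class of a point** — so the top-degree
analytic classes `A^g(X) = ℚ · [pt]` go to `A^{g'}(X')`, consistently with the general statement (Fulton,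
Example 1.7.4: `f_*[P] = [f(P)]`). [cite: Fulton1998, §1.4 and §1.7 Example 1.7.4] -/
theorem coe_gysinMap_analyticCycleClass_singleton_mem_analyticClasses
    (hF : ∀ x, Φ' ((A.map (Int.cast : ℤ → ℝ)) *ᵥ x) = F (Φ x)) (hfin : Finite (mapMatrixHom Φ Φ' A).ker)
    (x : ComplexTorus Φ) {g g' : ℕ} (hX : 2 * g + 2 * 0 = n) (hX' : 2 * g' + 2 * 0 = n') :
    ((gysinMap Φ Φ' e e' hX hX' A
        ⟨analyticCycleClass Φ e ((Nat.add_comm (2 * 0) (2 * g)).trans hX) (hasPureDim_singleton x),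
          analyticCycleClass_mem_rationalForms Φ e _ (hasPureDim_singleton x)⟩ : rationalForms Φ' (2 * g')) :
        E' [⋀^Fin (2 * g')]→L[ℝ] ℂ) ∈ analyticClasses Φ' e' g' := by
  rw [gysinMap_analyticCycleClass_singleton_of_finite_ker Φ Φ' e e' hF hfin x hX hX']
  exact analyticCycleClass_mem_analyticClasses Φ' e' _ (hasPureDim_singleton _)

end Finite

end ComplexTorus

end Literature.Geometry.Kaehler

end
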